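import Mathlib
import HarnessLib
import Literature.MathematicalPhysics.StatisticalMechanics.AbkmPackageSlots
import Summits.HubbardSuperconductivity.HubbardSuperconductivity.Theorems.ComplexGFFStiffnessHypALocalTwoPointTunedSystem
import Summits.HubbardSuperconductivity.HubbardSuperconductivity.Theorems.ComplexGFFStiffnessHypALocalTwoPointFormChangeOfSeed

/-!
# Crux `HypALocalTwoPoint`, line `gnv` — the `q`-SLOTS of the [ABKM19] package composed with the tuning
# map `q = hamTuningMap ρ` (census F1 residual: from the planner's `PackageData/PackageAt` slot vocabulary
# to the `h₀`-indexed hypotheses of `exists_freeEnergy_of_package`)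

Route `route-HubbardSuperconductivity-ComplexGFFStiffness`, crux item stmt-HubbardSuperconductivity-19155
(`HypALocalTwoPoint`), registered stub `stub_twoPointGivenZ` (⇐ `FreeEnergyBounds` ⇐ route children
`F4Statement 4`, `H1bcStatement 4`, `F1Residual`).  The nine `q`-slots `F4a … F4Φ22` and the state slot
`H1σ2` of `Literature/…/AbkmPackageSlots` are stated at the level of the tuning parameter `q` (symmetric,
`Σ|q_ij| ≤ T₀`).  The free-energy assembly `…FreeEnergyAt.exists_freeEnergy_of_package` consumes the same
regularity at the level of the relevant seed `h₀ ∈ E_0`, `‖h₀‖ ≤ ρ`, through `q = hamTuningMap ρ h₀`, which on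
the `ρ`-ball is the REAL-LINEAR map `hamQuadForm ∘ toHam` with entry sum `≤ c_q‖h₀‖`,
`c_q = 2d²/(|B_0|·(𝔥_0/L^0)²)`.  Hence (one line each in [ABKM19], Lemma 12.6): two points `h₀, h₀'` of the
ball map to two points of the `T₀`-ball at entry-distance `≤ c_q‖h₀ − h₀'‖`, and a parallelogram
`h₀, h₀+y, h₀+z, h₀+y+z` in the ball maps to the parallelogram `q, q+q(y), q+q(z), q+q(y)+q(z)` with
`Σ|q(y)| ≤ c_q‖y‖`; so every `q`-slot with size `s` yields the corresponding `h₀`-hypothesis with size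
`s·c_q` (first order) resp. `s·c_q²` (second order):

* `stepA_sub_le_of_F4a` (`ha`), `stepB_sub_le_of_F4b` (`hb`), `stepS_sub_of_F4l` (`hl`),
  `stepA_secondDiff_le_of_F4a2` (`hA2`), `stepB_secondDiff_le_of_F4b2` (`hB2`), `stepS_secondDiff_of_F4l2` (`hS2`),
  `stepS_sub_sub_of_F4l'` (`hl'`), `stepS_stateSecondDiff_of_H1σ2` (`hσ2`); the last-scale slots (F4Φ2), (F4Φ22)
  are treated in the sibling file `…SlotConversionLastScale`.

All proved, no `sorry`, no new definition; nothing here is specific to `d = 4`.  Honest scope: plumbing for a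
rung route (stiffness of a complex Gaussian gradient field); nothing about superconductivity in the Hubbard model.

## References
* S. Adams, S. Buchholz, R. Kotecký, S. Müller, arXiv:1910.13564, Lemma 12.6 (12.51)–(12.53), Lemma 8.4,
  Ch. 12.1 (12.8)–(12.11) [AdamsBuchholzKoteckyMuller2019].
-/

noncomputable section

-- `Summit.<Summit>.<Problem>`: single-conjunct summit, the duplicate component is mandated (D-0017).
set_option linter.dupNamespace false

namespace Summit.HubbardSuperconductivity.HubbardSuperconductivity.Theorems.ComplexGFF

open scoped BigOperators
open Real Finset MeasureTheory
open Literature.MathematicalPhysics.StatisticalMechanics.GradientRG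
open Literature.MathematicalPhysics.StatisticalMechanics.TorusPolymer (IsPolymer blockOf isPolymer_blockOf isConn_blockOf)
open Literature.MathematicalPhysics.QuantumFieldTheory
open Literature.Dynamics.Hyperbolic

variable {d : ℕ} (P : PackageData d) [Fact (0 < P.h)] [Fact (0 < P.L)] {N M : ℕ} [NeZero M]
  (Q : PackageAt P N M)

/-! ## Bookkeeping: nonnegativity / monotonicity of the activity-norm bounds, the entry sum -/

omit [Fact (0 < P.h)] [Fact (0 < P.L)] in
/-- The bound of `activityNormLE` is nonnegative at every scale for the package data (odd torus, `A ≥ 1`). -/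
theorem activityNormLE_nonneg_packageAt {k : ℕ} {K : activitySpace Q.normParams k} {C : ℝ}
    (hK : activityNormLE Q.normParams k K C) : 0 ≤ C := by
  have hA : 0 < Q.normParams.A := by show 0 < P.A; linarith [P.hA1]
  have hMo : Odd M := by rw [Q.hM]; exact P.hLodd.pow
  have hs : Odd (Q.normParams.L ^ k) := by show Odd (P.L ^ k); exact P.hLodd.pow
  exact activityNormLE_nonneg_abkm hA hMo hs hK

omit [Fact (0 < P.h)] [Fact (0 < P.L)] in
/-- Monotonicity of `activityNormLE` in the bound for the package data (`A ≥ 1 > 0`). -/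
theorem activityNormLE_mono_packageAt {k : ℕ} {K : activitySpace Q.normParams k} {C C' : ℝ}
    (hK : activityNormLE Q.normParams k K C) (hCC' : C ≤ C') : activityNormLE Q.normParams k K C' := by
  have hA : 0 < Q.normParams.A := by show 0 < P.A; linarith [P.hA1]
  exact WeakNormLE.mono hK hA hCC'

omit [NeZero M] in
/-- The entry sum is nonnegative. -/
theorem esum_nonneg (m : Matrix (Fin d) (Fin d) ℝ) : 0 ≤ esum m :=
  Finset.sum_nonneg fun _ _ => Finset.sum_nonneg fun _ _ => abs_nonneg _

/-! ## The tuning map on the `ρ`-ball: values in the `T₀`-ball, Lipschitz, linear on parallelograms -/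

/-- `Σ|q(toHam y)| ≤ c_q ‖y‖` for EVERY `y ∈ E_0` (`c_q = 2d²/(|B_0|(𝔥_0/L^0)²)`). -/
theorem esum_hamQuadForm_toHam_le
    (y : HamSpace ℂ d (fieldWt P.h (P.L : ℝ) d 0) ((P.L : ℝ) ^ 0) (P.L ^ (d * 0))) :
    esum (hamQuadForm (HamSpace.toHam y)) ≤
      2 * (d : ℝ) ^ 2 / (((P.L ^ (d * 0) : ℕ) : ℝ) * (fieldWt P.h (P.L : ℝ) d 0 / (P.L : ℝ) ^ 0) ^ 2) * ‖y‖ := by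
  have h𝔥 : 0 < fieldWt P.h (P.L : ℝ) d 0 := Fact.out
  have hR : 0 < (P.L : ℝ) ^ 0 := Fact.out
  have hn : 1 ≤ P.L ^ (d * 0) := Nat.one_le_iff_ne_zero.2 (Nat.pos_iff_ne_zero.1 (Fact.out : 0 < P.L ^ (d * 0)))
  rw [HamSpace.norm_def]
  exact entrySum_hamQuadForm_le h𝔥 hR hn _

/-- The tuning map takes the `ρ`-ball into the `T₀`-ball of symmetric matrices when `c_q ρ ≤ T₀`. -/
theorem inBall_hamTuningMap {ρ : ℝ} (hρ : 0 ≤ ρ)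
    (hqT₀ : 2 * (d : ℝ) ^ 2 / (((P.L ^ (d * 0) : ℕ) : ℝ) * (fieldWt P.h (P.L : ℝ) d 0 / (P.L : ℝ) ^ 0) ^ 2) * ρ ≤ P.T₀)
    (h₀ : HamSpace ℂ d (fieldWt P.h (P.L : ℝ) d 0) ((P.L : ℝ) ^ 0) (P.L ^ (d * 0))) :
    P.InBall (hamTuningMap ρ h₀) :=
  ⟨hamTuningMap_isSymm ρ h₀, (entrySum_hamTuningMap_le hρ h₀).trans hqT₀⟩

/-- Lipschitz bound of the tuning map on the ball in the entry sum: `Σ|q(h₀) − q(h₀')| ≤ c_q‖h₀ − h₀'‖`. -/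
theorem esum_hamTuningMap_sub_le {ρ : ℝ}
    (h₀ h₀' : HamSpace ℂ d (fieldWt P.h (P.L : ℝ) d 0) ((P.L : ℝ) ^ 0) (P.L ^ (d * 0)))
    (hh₀ : ‖h₀‖ ≤ ρ) (hh₀' : ‖h₀'‖ ≤ ρ) :
    esum (hamTuningMap ρ h₀ - hamTuningMap ρ h₀') ≤
      2 * (d : ℝ) ^ 2 / (((P.L ^ (d * 0) : ℕ) : ℝ) * (fieldWt P.h (P.L : ℝ) d 0 / (P.L : ℝ) ^ 0) ^ 2) * ‖h₀ - h₀'‖ :=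
  entrySum_hamTuningMap_sub_le h₀ h₀' hh₀ hh₀'

/-- Linearity on the ball: `q(h₀ + y) = q(h₀) + q(toHam y)` when `h₀, h₀ + y` lie in the `ρ`-ball. -/
theorem hamTuningMap_add_eq {ρ : ℝ}
    {h₀ y : HamSpace ℂ d (fieldWt P.h (P.L : ℝ) d 0) ((P.L : ℝ) ^ 0) (P.L ^ (d * 0))}
    (hh₀ : ‖h₀‖ ≤ ρ) (hy : ‖h₀ + y‖ ≤ ρ) :
    hamTuningMap ρ (h₀ + y) = hamTuningMap ρ h₀ + hamQuadForm (HamSpace.toHam y) := by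
  rw [hamTuningMap_of_le hy, hamTuningMap_of_le hh₀, map_add, hamQuadForm_add]

/-- Linearity on the ball, parallelogram form: `q(h₀ + y + z) = q(h₀) + q(toHam y) + q(toHam z)`. -/
theorem hamTuningMap_add_add_eq {ρ : ℝ}
    {h₀ y z : HamSpace ℂ d (fieldWt P.h (P.L : ℝ) d 0) ((P.L : ℝ) ^ 0) (P.L ^ (d * 0))}
    (hh₀ : ‖h₀‖ ≤ ρ) (hyz : ‖h₀ + y + z‖ ≤ ρ) :
    hamTuningMap ρ (h₀ + y + z) =
      hamTuningMap ρ h₀ + hamQuadForm (HamSpace.toHam y) + hamQuadForm (HamSpace.toHam z) := by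
  rw [hamTuningMap_of_le hyz, hamTuningMap_of_le hh₀, map_add, map_add, hamQuadForm_add, hamQuadForm_add]

/-! ## First-order `q`-slots ⟹ `h₀`-hypotheses `ha`, `hb`, `hl` (sizes `· c_q`) -/

/-- **(F4a) ⟹ `ha`**: `‖A_{q(h₀)}⁻¹w − A_{q(h₀')}⁻¹w‖ ≤ (a_T c_q)‖h₀ − h₀'‖‖w‖` on the `ρ`-ball. -/
theorem stepA_sub_le_of_F4a {aT ρ : ℝ} (haT : 0 ≤ aT) (hρ : 0 ≤ ρ)
    (hqT₀ : 2 * (d : ℝ) ^ 2 / (((P.L ^ (d * 0) : ℕ) : ℝ) * (fieldWt P.h (P.L : ℝ) d 0 / (P.L : ℝ) ^ 0) ^ 2) * ρ ≤ P.T₀) (hF : F4a P Q aT) :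
    ∀ h₀ h₀' : HamSpace ℂ d (fieldWt P.h (P.L : ℝ) d 0) ((P.L : ℝ) ^ 0) (P.L ^ (d * 0)), ‖h₀‖ ≤ ρ → ‖h₀'‖ ≤ ρ → ∀ k, k < N →
      ∀ w : HamSpace ℂ d (fieldWt P.h (P.L : ℝ) d (k + 1)) ((P.L : ℝ) ^ (k + 1)) (P.L ^ (d * (k + 1))),
        ‖(rgA P.L P.h (Q.kernels (hamTuningMap ρ h₀)) k).symm w
            - (rgA P.L P.h (Q.kernels (hamTuningMap ρ h₀')) k).symm w‖ ≤
          aT * (2 * (d : ℝ) ^ 2 / (((P.L ^ (d * 0) : ℕ) : ℝ) * (fieldWt P.h (P.L : ℝ) d 0 / (P.L : ℝ) ^ 0) ^ 2)) * ‖h₀ - h₀'‖ * ‖w‖ := by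
  intro h₀ h₀' hh₀ hh₀' k hk w
  have h1 := hF (hamTuningMap ρ h₀') (hamTuningMap ρ h₀) (inBall_hamTuningMap P hρ hqT₀ h₀')
    (inBall_hamTuningMap P hρ hqT₀ h₀) k (by omega) w
  have h2 := esum_hamTuningMap_sub_le P h₀ h₀' hh₀ hh₀'
  calc _ ≤ aT * esum (hamTuningMap ρ h₀ - hamTuningMap ρ h₀') * ‖w‖ := h1
    _ ≤ aT * (2 * (d : ℝ) ^ 2 / (((P.L ^ (d * 0) : ℕ) : ℝ) * (fieldWt P.h (P.L : ℝ) d 0 / (P.L : ℝ) ^ 0) ^ 2) * ‖h₀ - h₀'‖) * ‖w‖ := by gcongr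
    _ = _ := by ring

/-- **(F4b) ⟹ `hb`**: `‖B_{q(h₀)}v − B_{q(h₀')}v‖ ≤ (b_T c_q)‖h₀ − h₀'‖·c_v` on the `ρ`-ball. -/
theorem stepB_sub_le_of_F4b {bT ρ : ℝ} (hbT : 0 ≤ bT) (hρ : 0 ≤ ρ)
    (hqT₀ : 2 * (d : ℝ) ^ 2 / (((P.L ^ (d * 0) : ℕ) : ℝ) * (fieldWt P.h (P.L : ℝ) d 0 / (P.L : ℝ) ^ 0) ^ 2) * ρ ≤ P.T₀) (hF : F4b P Q bT) :
    ∀ h₀ h₀' : HamSpace ℂ d (fieldWt P.h (P.L : ℝ) d 0) ((P.L : ℝ) ^ 0) (P.L ^ (d * 0)), ‖h₀‖ ≤ ρ → ‖h₀'‖ ≤ ρ → ∀ k, k < N →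
      ∀ (v : activitySpace Q.normParams k) (cv : ℝ), activityNormLE Q.normParams k v cv →
        ‖Q.opB (hamTuningMap ρ h₀) k v - Q.opB (hamTuningMap ρ h₀') k v‖ ≤
          bT * (2 * (d : ℝ) ^ 2 / (((P.L ^ (d * 0) : ℕ) : ℝ) * (fieldWt P.h (P.L : ℝ) d 0 / (P.L : ℝ) ^ 0) ^ 2)) * ‖h₀ - h₀'‖ * cv := by
  intro h₀ h₀' hh₀ hh₀' k hk v cv hv
  have hcv := activityNormLE_nonneg_packageAt P Q hv
  have h1 := hF (hamTuningMap ρ h₀') (hamTuningMap ρ h₀) (inBall_hamTuningMap P hρ hqT₀ h₀')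
    (inBall_hamTuningMap P hρ hqT₀ h₀) k (by omega) v cv hv
  have h2 := esum_hamTuningMap_sub_le P h₀ h₀' hh₀ hh₀'
  calc _ ≤ bT * esum (hamTuningMap ρ h₀ - hamTuningMap ρ h₀') * cv := h1
    _ ≤ bT * (2 * (d : ℝ) ^ 2 / (((P.L ^ (d * 0) : ℕ) : ℝ) * (fieldWt P.h (P.L : ℝ) d 0 / (P.L : ℝ) ^ 0) ^ 2) * ‖h₀ - h₀'‖) * cv := by gcongr
    _ = _ := by ring

/-- **(F4l) ⟹ `hl`**: `‖S_{q(h₀)}(u,v) − S_{q(h₀')}(u,v)‖_{k+1} ≤ (l_T c_q)‖h₀ − h₀'‖ max(‖u‖, c_v)` on the balls. -/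
theorem stepS_sub_of_F4l {lT ρ : ℝ} (hlT : 0 ≤ lT) (hρ : 0 ≤ ρ)
    (hqT₀ : 2 * (d : ℝ) ^ 2 / (((P.L ^ (d * 0) : ℕ) : ℝ) * (fieldWt P.h (P.L : ℝ) d 0 / (P.L : ℝ) ^ 0) ^ 2) * ρ ≤ P.T₀) (hF : F4l P Q lT) :
    ∀ h₀ h₀' : HamSpace ℂ d (fieldWt P.h (P.L : ℝ) d 0) ((P.L : ℝ) ^ 0) (P.L ^ (d * 0)), ‖h₀‖ ≤ ρ → ‖h₀'‖ ≤ ρ → ∀ k, k < N →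
      ∀ (u : HamSpace ℂ d (fieldWt P.h (P.L : ℝ) d k) ((P.L : ℝ) ^ k) (P.L ^ (d * k))) (v : activitySpace Q.normParams k) (cv : ℝ), ‖u‖ ≤ P.r →
        activityNormLE Q.normParams k v cv → cv ≤ P.r →
        activityNormLE Q.normParams (k + 1)
          (Q.opS (hamTuningMap ρ h₀) k u v - Q.opS (hamTuningMap ρ h₀') k u v)
          (lT * (2 * (d : ℝ) ^ 2 / (((P.L ^ (d * 0) : ℕ) : ℝ) * (fieldWt P.h (P.L : ℝ) d 0 / (P.L : ℝ) ^ 0) ^ 2)) * ‖h₀ - h₀'‖ * max ‖u‖ cv) := by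
  intro h₀ h₀' hh₀ hh₀' k hk u v cv hu hv hcv
  have h1 := hF (hamTuningMap ρ h₀) (hamTuningMap ρ h₀') (inBall_hamTuningMap P hρ hqT₀ h₀)
    (inBall_hamTuningMap P hρ hqT₀ h₀') k (by omega) u v cv hu hv hcv
  refine activityNormLE_mono_packageAt P Q h1 ?_
  have h2 := esum_hamTuningMap_sub_le P h₀ h₀' hh₀ hh₀'
  have hm : 0 ≤ max ‖u‖ cv := (norm_nonneg u).trans (le_max_left _ _)
  calc lT * esum (hamTuningMap ρ h₀ - hamTuningMap ρ h₀') * max ‖u‖ cv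
        ≤ lT * (2 * (d : ℝ) ^ 2 / (((P.L ^ (d * 0) : ℕ) : ℝ) * (fieldWt P.h (P.L : ℝ) d 0 / (P.L : ℝ) ^ 0) ^ 2) * ‖h₀ - h₀'‖) * max ‖u‖ cv := by gcongr
    _ = _ := by ring

/-! ## Second-order `q`-slots ⟹ `hA2`, `hB2`, `hS2` (sizes `· c_q²`), the mixed slot `hl'`, the state slot `hσ2` -/

/-- **(F4a2) ⟹ `hA2`**: mixed second differences of `h₀ ↦ A_{q(h₀)}⁻¹` on parallelograms in the `ρ`-ball. -/
theorem stepA_secondDiff_le_of_F4a2 {aTT ρ : ℝ} (haTT : 0 ≤ aTT) (hρ : 0 ≤ ρ)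
    (hqT₀ : 2 * (d : ℝ) ^ 2 / (((P.L ^ (d * 0) : ℕ) : ℝ) * (fieldWt P.h (P.L : ℝ) d 0 / (P.L : ℝ) ^ 0) ^ 2) * ρ ≤ P.T₀) (hF : F4a2 P Q aTT) :
    ∀ h₀ y z : HamSpace ℂ d (fieldWt P.h (P.L : ℝ) d 0) ((P.L : ℝ) ^ 0) (P.L ^ (d * 0)), ‖h₀‖ ≤ ρ → ‖h₀ + y‖ ≤ ρ → ‖h₀ + z‖ ≤ ρ → ‖h₀ + y + z‖ ≤ ρ →
      ∀ k, k < N → ∀ w : HamSpace ℂ d (fieldWt P.h (P.L : ℝ) d (k + 1)) ((P.L : ℝ) ^ (k + 1)) (P.L ^ (d * (k + 1))),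
        ‖(rgA P.L P.h (Q.kernels (hamTuningMap ρ (h₀ + y + z))) k).symm w
            - (rgA P.L P.h (Q.kernels (hamTuningMap ρ (h₀ + y))) k).symm w
            - (rgA P.L P.h (Q.kernels (hamTuningMap ρ (h₀ + z))) k).symm w
            + (rgA P.L P.h (Q.kernels (hamTuningMap ρ h₀)) k).symm w‖ ≤
          aTT * (2 * (d : ℝ) ^ 2 / (((P.L ^ (d * 0) : ℕ) : ℝ) * (fieldWt P.h (P.L : ℝ) d 0 / (P.L : ℝ) ^ 0) ^ 2)) ^ 2 * ‖y‖ * ‖z‖ * ‖w‖ := by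
  intro h₀ y z hh₀ hy hz hyz k hk w
  have hb0 := inBall_hamTuningMap P hρ hqT₀ h₀
  have hby := inBall_hamTuningMap P hρ hqT₀ (h₀ + y)
  have hbz := inBall_hamTuningMap P hρ hqT₀ (h₀ + z)
  have hbyz := inBall_hamTuningMap P hρ hqT₀ (h₀ + y + z)
  have ey := hamTuningMap_add_eq P hh₀ hy
  have ez := hamTuningMap_add_eq P hh₀ hz
  have eyz := hamTuningMap_add_add_eq P hh₀ hyz
  rw [eyz] at hbyz
  rw [ey] at hby
  rw [ez] at hbz
  rw [eyz, ey, ez]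
  have h1 := hF (hamTuningMap ρ h₀) (hamQuadForm (HamSpace.toHam y)) (hamQuadForm (HamSpace.toHam z))
    hb0 hby hbz hbyz k (by omega) w
  have h2 := esum_hamQuadForm_toHam_le P y
  have h3 := esum_hamQuadForm_toHam_le P z
  have h4 := esum_nonneg (hamQuadForm (HamSpace.toHam y))
  have h5 := esum_nonneg (hamQuadForm (HamSpace.toHam z))
  calc _ ≤ aTT * esum (hamQuadForm (HamSpace.toHam y)) * esum (hamQuadForm (HamSpace.toHam z)) * ‖w‖ := h1
    _ ≤ aTT * (2 * (d : ℝ) ^ 2 / (((P.L ^ (d * 0) : ℕ) : ℝ) * (fieldWt P.h (P.L : ℝ) d 0 / (P.L : ℝ) ^ 0) ^ 2) * ‖y‖) * (2 * (d : ℝ) ^ 2 / (((P.L ^ (d * 0) : ℕ) : ℝ) * (fieldWt P.h (P.L : ℝ) d 0 / (P.L : ℝ) ^ 0) ^ 2) * ‖z‖) * ‖w‖ := by gcongr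
    _ = _ := by ring

/-- **(F4b2) ⟹ `hB2`**: mixed second differences of `h₀ ↦ B_{q(h₀)}v` on parallelograms in the `ρ`-ball. -/
theorem stepB_secondDiff_le_of_F4b2 {bTT ρ : ℝ} (hbTT : 0 ≤ bTT) (hρ : 0 ≤ ρ)
    (hqT₀ : 2 * (d : ℝ) ^ 2 / (((P.L ^ (d * 0) : ℕ) : ℝ) * (fieldWt P.h (P.L : ℝ) d 0 / (P.L : ℝ) ^ 0) ^ 2) * ρ ≤ P.T₀) (hF : F4b2 P Q bTT) :
    ∀ h₀ y z : HamSpace ℂ d (fieldWt P.h (P.L : ℝ) d 0) ((P.L : ℝ) ^ 0) (P.L ^ (d * 0)), ‖h₀‖ ≤ ρ → ‖h₀ + y‖ ≤ ρ → ‖h₀ + z‖ ≤ ρ → ‖h₀ + y + z‖ ≤ ρ →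
      ∀ k, k < N → ∀ (v : activitySpace Q.normParams k) (cv : ℝ), activityNormLE Q.normParams k v cv →
        ‖Q.opB (hamTuningMap ρ (h₀ + y + z)) k v - Q.opB (hamTuningMap ρ (h₀ + y)) k v
            - Q.opB (hamTuningMap ρ (h₀ + z)) k v + Q.opB (hamTuningMap ρ h₀) k v‖ ≤
          bTT * (2 * (d : ℝ) ^ 2 / (((P.L ^ (d * 0) : ℕ) : ℝ) * (fieldWt P.h (P.L : ℝ) d 0 / (P.L : ℝ) ^ 0) ^ 2)) ^ 2 * ‖y‖ * ‖z‖ * cv := by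
  intro h₀ y z hh₀ hy hz hyz k hk v cv hv
  have hcv := activityNormLE_nonneg_packageAt P Q hv
  have hb0 := inBall_hamTuningMap P hρ hqT₀ h₀
  have hby := inBall_hamTuningMap P hρ hqT₀ (h₀ + y)
  have hbz := inBall_hamTuningMap P hρ hqT₀ (h₀ + z)
  have hbyz := inBall_hamTuningMap P hρ hqT₀ (h₀ + y + z)
  have ey := hamTuningMap_add_eq P hh₀ hy
  have ez := hamTuningMap_add_eq P hh₀ hz
  have eyz := hamTuningMap_add_add_eq P hh₀ hyz
  rw [eyz] at hbyz
  rw [ey] at hby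
  rw [ez] at hbz
  rw [eyz, ey, ez]
  have h1 := hF (hamTuningMap ρ h₀) (hamQuadForm (HamSpace.toHam y)) (hamQuadForm (HamSpace.toHam z))
    hb0 hby hbz hbyz k (by omega) v cv hv
  have h2 := esum_hamQuadForm_toHam_le P y
  have h3 := esum_hamQuadForm_toHam_le P z
  have h4 := esum_nonneg (hamQuadForm (HamSpace.toHam y))
  have h5 := esum_nonneg (hamQuadForm (HamSpace.toHam z))
  calc _ ≤ bTT * esum (hamQuadForm (HamSpace.toHam y)) * esum (hamQuadForm (HamSpace.toHam z)) * cv := h1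
    _ ≤ bTT * (2 * (d : ℝ) ^ 2 / (((P.L ^ (d * 0) : ℕ) : ℝ) * (fieldWt P.h (P.L : ℝ) d 0 / (P.L : ℝ) ^ 0) ^ 2) * ‖y‖) * (2 * (d : ℝ) ^ 2 / (((P.L ^ (d * 0) : ℕ) : ℝ) * (fieldWt P.h (P.L : ℝ) d 0 / (P.L : ℝ) ^ 0) ^ 2) * ‖z‖) * cv := by gcongr
    _ = _ := by ring

/-- **(F4l2) ⟹ `hS2`**: mixed second differences of `h₀ ↦ S_{q(h₀)}(u, v)` on parallelograms in the `ρ`-ball,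
in the activity norm. -/
theorem stepS_secondDiff_of_F4l2 {lTT ρ : ℝ} (hlTT : 0 ≤ lTT) (hρ : 0 ≤ ρ)
    (hqT₀ : 2 * (d : ℝ) ^ 2 / (((P.L ^ (d * 0) : ℕ) : ℝ) * (fieldWt P.h (P.L : ℝ) d 0 / (P.L : ℝ) ^ 0) ^ 2) * ρ ≤ P.T₀) (hF : F4l2 P Q lTT) :
    ∀ h₀ y z : HamSpace ℂ d (fieldWt P.h (P.L : ℝ) d 0) ((P.L : ℝ) ^ 0) (P.L ^ (d * 0)), ‖h₀‖ ≤ ρ → ‖h₀ + y‖ ≤ ρ → ‖h₀ + z‖ ≤ ρ → ‖h₀ + y + z‖ ≤ ρ →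
      ∀ k, k < N → ∀ (u : HamSpace ℂ d (fieldWt P.h (P.L : ℝ) d k) ((P.L : ℝ) ^ k) (P.L ^ (d * k))) (v : activitySpace Q.normParams k) (cv : ℝ), ‖u‖ ≤ P.r →
        activityNormLE Q.normParams k v cv → cv ≤ P.r →
        activityNormLE Q.normParams (k + 1)
          (Q.opS (hamTuningMap ρ (h₀ + y + z)) k u v - Q.opS (hamTuningMap ρ (h₀ + y)) k u v
            - Q.opS (hamTuningMap ρ (h₀ + z)) k u v + Q.opS (hamTuningMap ρ h₀) k u v)
          (lTT * (2 * (d : ℝ) ^ 2 / (((P.L ^ (d * 0) : ℕ) : ℝ) * (fieldWt P.h (P.L : ℝ) d 0 / (P.L : ℝ) ^ 0) ^ 2)) ^ 2 * ‖y‖ * ‖z‖ * max ‖u‖ cv) := by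
  intro h₀ y z hh₀ hy hz hyz k hk u v cv hu hv hcv
  have hb0 := inBall_hamTuningMap P hρ hqT₀ h₀
  have hby := inBall_hamTuningMap P hρ hqT₀ (h₀ + y)
  have hbz := inBall_hamTuningMap P hρ hqT₀ (h₀ + z)
  have hbyz := inBall_hamTuningMap P hρ hqT₀ (h₀ + y + z)
  have ey := hamTuningMap_add_eq P hh₀ hy
  have ez := hamTuningMap_add_eq P hh₀ hz
  have eyz := hamTuningMap_add_add_eq P hh₀ hyz
  rw [eyz] at hbyz
  rw [ey] at hby
  rw [ez] at hbz
  rw [eyz, ey, ez]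
  have h1 := hF (hamTuningMap ρ h₀) (hamQuadForm (HamSpace.toHam y)) (hamQuadForm (HamSpace.toHam z))
    hb0 hby hbz hbyz k (by omega) u v cv hu hv hcv
  refine activityNormLE_mono_packageAt P Q h1 ?_
  have h2 := esum_hamQuadForm_toHam_le P y
  have h3 := esum_hamQuadForm_toHam_le P z
  have h4 := esum_nonneg (hamQuadForm (HamSpace.toHam y))
  have h5 := esum_nonneg (hamQuadForm (HamSpace.toHam z))
  have hm : 0 ≤ max ‖u‖ cv := (norm_nonneg u).trans (le_max_left _ _)
  calc lTT * esum (hamQuadForm (HamSpace.toHam y)) * esum (hamQuadForm (HamSpace.toHam z)) * max ‖u‖ cv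
        ≤ lTT * (2 * (d : ℝ) ^ 2 / (((P.L ^ (d * 0) : ℕ) : ℝ) * (fieldWt P.h (P.L : ℝ) d 0 / (P.L : ℝ) ^ 0) ^ 2) * ‖y‖) * (2 * (d : ℝ) ^ 2 / (((P.L ^ (d * 0) : ℕ) : ℝ) * (fieldWt P.h (P.L : ℝ) d 0 / (P.L : ℝ) ^ 0) ^ 2) * ‖z‖) * max ‖u‖ cv := by gcongr
    _ = _ := by ring

/-- **(F4l') ⟹ `hl'`**: the `q`-difference of `S_k` along the tuning map is Lipschitz in the state. -/
theorem stepS_sub_sub_of_F4l' {lT' ρ : ℝ} (hlT' : 0 ≤ lT') (hρ : 0 ≤ ρ)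
    (hqT₀ : 2 * (d : ℝ) ^ 2 / (((P.L ^ (d * 0) : ℕ) : ℝ) * (fieldWt P.h (P.L : ℝ) d 0 / (P.L : ℝ) ^ 0) ^ 2) * ρ ≤ P.T₀) (hF : F4l' P Q lT') :
    ∀ h₀ h₀' : HamSpace ℂ d (fieldWt P.h (P.L : ℝ) d 0) ((P.L : ℝ) ^ 0) (P.L ^ (d * 0)), ‖h₀‖ ≤ ρ → ‖h₀'‖ ≤ ρ → ∀ k, k < N →
      ∀ (u u' : HamSpace ℂ d (fieldWt P.h (P.L : ℝ) d k) ((P.L : ℝ) ^ k) (P.L ^ (d * k))) (v v' : activitySpace Q.normParams k) (cv cv' cd : ℝ), ‖u‖ ≤ P.r → ‖u'‖ ≤ P.r →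
        activityNormLE Q.normParams k v cv → cv ≤ P.r → activityNormLE Q.normParams k v' cv' → cv' ≤ P.r →
        activityNormLE Q.normParams k (v - v') cd →
        activityNormLE Q.normParams (k + 1)
          ((Q.opS (hamTuningMap ρ h₀') k u v - Q.opS (hamTuningMap ρ h₀) k u v)
            - (Q.opS (hamTuningMap ρ h₀') k u' v' - Q.opS (hamTuningMap ρ h₀) k u' v'))
          (lT' * (2 * (d : ℝ) ^ 2 / (((P.L ^ (d * 0) : ℕ) : ℝ) * (fieldWt P.h (P.L : ℝ) d 0 / (P.L : ℝ) ^ 0) ^ 2)) * ‖h₀' - h₀‖ * max ‖u - u'‖ cd) := by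
  intro h₀ h₀' hh₀ hh₀' k hk u u' v v' cv cv' cd hu hu' hv hcv hv' hcv' hd
  have h1 := hF (hamTuningMap ρ h₀) (hamTuningMap ρ h₀') (inBall_hamTuningMap P hρ hqT₀ h₀)
    (inBall_hamTuningMap P hρ hqT₀ h₀') k (by omega) u u' v v' cv cv' cd hu hu' hv hcv hv' hcv' hd
  refine activityNormLE_mono_packageAt P Q h1 ?_
  have h2 := esum_hamTuningMap_sub_le P h₀' h₀ hh₀' hh₀
  have hm : 0 ≤ max ‖u - u'‖ cd := (norm_nonneg _).trans (le_max_left _ _)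
  calc lT' * esum (hamTuningMap ρ h₀' - hamTuningMap ρ h₀) * max ‖u - u'‖ cd
        ≤ lT' * (2 * (d : ℝ) ^ 2 / (((P.L ^ (d * 0) : ℕ) : ℝ) * (fieldWt P.h (P.L : ℝ) d 0 / (P.L : ℝ) ^ 0) ^ 2) * ‖h₀' - h₀‖) * max ‖u - u'‖ cd := by gcongr
    _ = _ := by ring

/-- **(H1σ2) ⟹ `hσ2`**: the joint state second differences of `S_{q(h₀)}` at a seed of the `ρ`-ball (verbatim). -/
theorem stepS_stateSecondDiff_of_H1σ2 {σ₂ ρ : ℝ} (hρ : 0 ≤ ρ)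
    (hqT₀ : 2 * (d : ℝ) ^ 2 / (((P.L ^ (d * 0) : ℕ) : ℝ) * (fieldWt P.h (P.L : ℝ) d 0 / (P.L : ℝ) ^ 0) ^ 2) * ρ ≤ P.T₀) (hF : H1σ2 P Q σ₂) :
    ∀ h₀ : HamSpace ℂ d (fieldWt P.h (P.L : ℝ) d 0) ((P.L : ℝ) ^ 0) (P.L ^ (d * 0)), ‖h₀‖ ≤ ρ → ∀ k, k < N →
      ∀ (u y z : HamSpace ℂ d (fieldWt P.h (P.L : ℝ) d k) ((P.L : ℝ) ^ k) (P.L ^ (d * k))) (v y' z' : activitySpace Q.normParams k) (cv cvy cvz cvyz cy cz : ℝ),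
        ‖u‖ ≤ P.r → ‖u + y‖ ≤ P.r → ‖u + z‖ ≤ P.r → ‖u + y + z‖ ≤ P.r →
        activityNormLE Q.normParams k v cv → cv ≤ P.r →
        activityNormLE Q.normParams k (v + y') cvy → cvy ≤ P.r →
        activityNormLE Q.normParams k (v + z') cvz → cvz ≤ P.r →
        activityNormLE Q.normParams k (v + y' + z') cvyz → cvyz ≤ P.r →
        activityNormLE Q.normParams k y' cy → activityNormLE Q.normParams k z' cz →
        activityNormLE Q.normParams (k + 1)
          (Q.opS (hamTuningMap ρ h₀) k (u + y + z) (v + y' + z') - Q.opS (hamTuningMap ρ h₀) k (u + y) (v + y')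
            - Q.opS (hamTuningMap ρ h₀) k (u + z) (v + z') + Q.opS (hamTuningMap ρ h₀) k u v)
          (σ₂ * max ‖y‖ cy * max ‖z‖ cz) :=
  fun h₀ _ k hk => hF (hamTuningMap ρ h₀) (inBall_hamTuningMap P hρ hqT₀ h₀) k (by omega)

end Summit.HubbardSuperconductivity.HubbardSuperconductivity.Theorems.ComplexGFF

end
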